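/-
Copyright (c) 2026 the pub-hodgecm-mathlib formalisation cell (harness21).  Prover seat hodgecm-mathlib-K2E1-p13 (g5), Track B ∕ K2-LIT, h413 = `stmt-HodgeConjecture-24833`,
R90-TF section S8 «ContSpec-n½» (dealer R90-CS-plan (g3), deals S8-R169 ∕ S8-R171 (3); census `R90/S8/CENSUS-ArchSectionLOnBigCell.K2E1-p13-g5.md`): the ARCHIMEDEAN
IDENTIFICATION — the per-place value of the last-row character `Θ_w(λ) = χ₁,w(λ̄⁻¹)·χ₂,w(λ̄∕λ)` of ★ `archSectionL` (K2E1-p11) in the archimedean-type currency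
`archUnitaryValue m t z = (z∕|z|)^m·|z|^{it}`, and its value on the big cell `λ = Z_w − 1 = −conj Z^{CS}_w` — §1, the scalar dictionary.
-/
import Literature.NumberTheory.GaloisRepresentations.HeckeCharacterArchType      -- ★ `archUnitaryValue`, `HeckeCharacter.HasUnitaryArchType`, `norm_archUnitaryValue`
import Literature.NumberTheory.GaloisRepresentations.HeckeCharacterArchTypeProofs                  -- ★ `archUnitaryValue_mul` (ED. 2)
import Literature.NumberTheory.GaloisRepresentations.AlgebraicHeckeCharacterGrossencharakterProofs  -- ★ `InfiniteIdele.extensionEmbedding_apply_ne_zero` (ED. 2)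
import Literature.NumberTheory.Automorphic.Arthur2013.Leaves.TorusDictionary                        -- ★ `TorusDict.extensionEmbedding_smul` (c = conj on each arch coordinate), `TorusDict.smul_infiniteIdeles` (ED. 2)
import Literature.NumberTheory.Rogawski1990.OneDimAutRepH                                           -- ★ `OneDimAutRepH.bcψ_apply`, `hasUnitaryArchType_bcψ` (ED. 2)
import Literature.RepresentationTheory.HarrisKudlaSweet1996.SplittingCharactersCM                     -- ★ `IsSplittingChar.exists_hasUnitaryArchType` (ED. 3: `μω`'s odd type from `hquad`)
import Summits.HodgeConjecture.HodgeConjecture.Theorems.R90S8ChiSectionPairArchSectionAlgebraU3     -- ★ p863607 (K2E1-p11, 3a): `lastRowChar_coe_units`; brings ★ p863618 defs `lastRowChar`, `idelePhase`, `archSectionL` (ED. 2)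
import Summits.HodgeConjecture.HodgeConjecture.Theorems.R90S8ChiSectionPairArchSectionWitnessEU3    -- ★ (K2E1-p11, 3c-E): `archSectionE_eq` (`ρ_E ≡ 1`, ★ `archRowFactorE_eq_one`) over ★ ED. 3 defs `archSectionE` (ED. 4)
import Mathlib.Analysis.SpecialFunctions.Pow.Complex
import HarnessLib

/-!
# K2·E1 ∕ R90·S8 — `K2E1ArchSectionLOnBigCellU3`: THE ARCHIMEDEAN IDENTIFICATION, §1 SCALAR DICTIONARY — `χ₁,w(λ̄⁻¹)·χ₂,w(λ̄∕λ)` IN ARCHIMEDEAN TYPES IS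
# `archUnitaryValue (m₁ − 2e₂) (−t₁) λ`, AND ON THE BIG CELL (`λ = Z_w − 1 = −conj Z^{CS}_w`) IT IS `(−1)^{m_w}·(conj Z^{CS}∕|Z^{CS}|)^{m_w}·|Z^{CS}|^{−it₁}`

Cell `pub/hodgecm-mathlib`, crux h413 = `stmt-HodgeConjecture-24833`, route of record `HCCMUnconditional`; R90-TF section S8 «ContSpec-n½», road R2-χ₃ ∕ junction J-S8-∞′ (the archimedean
half of ★ F5's binder `hA32`; consumers: R90-CS-p03's (a-10) `K2E1ChiArchNonvanishingAssemblyU3` — per place `(4b)`-core at `(−m_w, 3∕2 + it_w∕2)` —, K2E1-p11's FILE 3c (the witness section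
★ `archSectionL χ₁ χ₂ = Θ(ℓ)·ρ_ℓ·χ₂⟨det⟩`, `ℓ = x₂ − x₀`), K2E2-p12's (V) row `ω_∞`).  THEOREMS ONLY (no `def`, no `instance`, no notation, no named-fact hypothesis, no `sorry`; default
heartbeats); lane `--supports stmt-HodgeConjecture-24833 --as helper` (count-neutral).  Closes no socket.

THE MATHEMATICS ([Patrikis2019] §2.1; [Rogawski1990] §12.3 p. 178, §13.9; [MoeglinWaldspurger1995] IV.1.11).  A unitary character of `ℂ^×` of archimedean type `(m, t)` is
`z ↦ archUnitaryValue m t z = (z∕|z|)^m |z|^{it}` (★ `HeckeCharacterArchType`).  The last-row character of ★ `archSectionL` at a complex place is `Θ_w(λ) = χ₁,w(λ̄⁻¹)·χ₂,w(λ̄∕λ)`;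
with `χ₁,w` of type `(m₁, t₁)` and `χ₂,w(u) = u^{e₂}` on `U(1)` (the pullback `z ↦ χ₂,w(z̄∕z)` has the EVEN type `(−2e₂, 0)`, ★ `OneDimAutRepH.hasUnitaryArchType_bcψ`'s currency up to the
orientation of ★ `TorusDict.pullback`):
* `archUnitaryValue_conj_inv`: `χ₁,w(λ̄⁻¹) = archUnitaryValue m₁ t₁ (conj λ)⁻¹ = archUnitaryValue m₁ (−t₁) λ` (the unit part of `λ̄⁻¹ = λ∕|λ|²` is `λ∕|λ|`, the modulus `|λ|⁻¹`);
* `archUnitaryValue_conj_div_self`: `(λ̄∕λ)^{e} = archUnitaryValue (−2e) 0 λ` (and `archUnitaryValue_div_conj_self`: `(λ∕λ̄)^e = archUnitaryValue (2e) 0 λ`, the other orientation);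
* `archUnitaryValue_add`: types add — so **`Θ_w(λ) = archUnitaryValue (m₁ − 2e₂) (−t₁) λ`** (`theta_eq_archUnitaryValue`), ONE integer `m_w := m₁,w − 2e₂,w` (= p11's `k₁ − 2k₂`; = the
  `c = m₁ − 2m₂` of ★ p863599's `K_∞`-type dictionary on `T ∩ K_∞`) and one real `t_w` (`= −t₁,w`; `0` for the block of record, whose three factors `ξ.bcη⁻¹, ξ.bcψ⁻¹, μω` have `t = 0`);
* `archUnitaryValue_neg`, `archUnitaryValue_neg_conj`: ON THE BIG CELL `λ = ℓ_w = Z_w − 1 = −conj Z^{CS}_w` (`Z^{CS} = 1 − Z̄ = A + iBs`, ★ p863599 `ell_row_two_bigCell`):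
  **`archUnitaryValue M t (−conj W) = (−1)^M · conj (archUnitaryValue M (−t) W)`** `= (−1)^M (conj W∕|W|)^M |W|^{it}` — R90-CS-p03's (4b) Beta integrand `(A − iBs)^M (A² + B²s²)^{…}` with the sign
  `ε = (−1)^M`, NO `X_w`-phase (the modulus `|W|² = (1 + |X|²∕2)² + (Im Z)²` is ★ p863579 `norm_sq_one_sub_eq_arch`).
§2 (the adelic evaluation of ★ `archSectionL` on the last-row data) follows in ED. 2 once the `conjAdele ∘ infiniteIdeles` and ★ `TorusDict.pullback_apply` orientation are read (census §3).
HONEST LABEL: HC_CM is proved only modulo the 7 printed citations (2 remaining named inputs: hLiu418 = `stmt-HodgeConjecture-24832`, h413 = `stmt-HodgeConjecture-24833`) until rung 0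
closes; REL ≠ ★ ≠ BUILT; this file asserts no named fact and closes no socket; count-neutral; unconditional complex analysis.

## References
* [Patrikis2019] S. Patrikis, *Variations on a theorem of Tate*, Mem. AMS 258 (2019): §2.1 (archimedean parameters `(m_w, t_w)`).
* [Rogawski1990] J. D. Rogawski, *Automorphic Representations of Unitary Groups in Three Variables*, Ann. of Math. Stud. 123 (1990): §12.3 p. 178, §13.9 p. 229.
* [MoeglinWaldspurger1995] C. Mœglin, J.-L. Waldspurger, *Spectral Decomposition and Eisenstein Series* (1995): IV.1.11.
-/

set_option autoImplicit false
set_option linter.dupNamespace false -- the mandated namespace repeats `HodgeConjecture.HodgeConjecture`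

noncomputable section

open scoped ComplexConjugate
open Literature.NumberTheory.GaloisRepresentations

namespace Summit.HodgeConjecture.HodgeConjecture.Cruxes.H413.K2E1ArchSectionLOnBigCellU3

/-! ## §1 The scalar dictionary: `archUnitaryValue` at `λ̄⁻¹`, at the phase `λ̄∕λ`, additivity of types, and the value at `−conj W` -/

/-- `(conj z)⁻¹ = z ∕ |z|²` in `ℂ`. [folklore] -/
theorem inv_conj_eq_div_norm_sq (z : ℂ) : (conj z)⁻¹ = z / ((‖z‖ : ℂ) ^ 2) := by
  rcases eq_or_ne z 0 with rfl | hz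
  · simp
  · have hcz : conj z ≠ 0 := (map_ne_zero _).2 hz
    have hne : ((‖z‖ : ℂ) ^ 2) ≠ 0 := pow_ne_zero _ (by exact_mod_cast norm_ne_zero_iff.2 hz)
    rw [eq_div_iff hne, ← Complex.mul_conj', mul_comm z (conj z), ← mul_assoc, inv_mul_cancel₀ hcz, one_mul]

/-- **`χ(λ̄⁻¹)` IN TYPES**: `archUnitaryValue m t (conj z)⁻¹ = archUnitaryValue m (−t) z` (`z ≠ 0`): the unit part of `z̄⁻¹ = z∕|z|²` is `z∕|z|`, its modulus is `|z|⁻¹`, and `(|z|⁻¹)^{it} = |z|^{−it}`.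
[cite: Patrikis2019, §2.1] -/
theorem archUnitaryValue_conj_inv {z : ℂ} (hz : z ≠ 0) (m : ℤ) (t : ℝ) :
    archUnitaryValue m t (conj z)⁻¹ = archUnitaryValue m (-t) z := by
  have hn : 0 < ‖z‖ := norm_pos_iff.2 hz
  have hnC : ((‖z‖ : ℝ) : ℂ) ≠ 0 := by exact_mod_cast hn.ne'
  unfold archUnitaryValue
  have h1 : ‖(conj z)⁻¹‖ = ‖z‖⁻¹ := by rw [norm_inv, Complex.norm_conj]
  rw [h1, inv_conj_eq_div_norm_sq]
  congr 1
  · -- unit parts agree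
    congr 1
    rw [Complex.ofReal_inv]
    field_simp
  · -- `(|z|⁻¹)^{it} = |z|^{i(−t)}`
    rw [Complex.ofReal_inv, Complex.inv_cpow _ _ (by rw [Complex.arg_ofReal_of_nonneg hn.le]; exact Real.pi_pos.ne), ← Complex.cpow_neg]
    congr 1
    push_cast
    ring

/-- **THE `U(1)`-CHARACTER AT THE PHASE `λ̄∕λ`**: `(conj z ∕ z)^e = archUnitaryValue (−2e) 0 z` (`z ≠ 0`; `conj z∕z = (z∕|z|)⁻²`). [cite: Rogawski1990, §12.3 p. 178] -/
theorem archUnitaryValue_conj_div_self {z : ℂ} (hz : z ≠ 0) (e : ℤ) :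
    (conj z / z) ^ e = archUnitaryValue (-2 * e) 0 z := by
  have key : ((z / (‖z‖ : ℂ)) ^ 2)⁻¹ = conj z / z := by
    rw [div_pow, inv_div, ← Complex.mul_conj', pow_two, mul_comm z (conj z), mul_div_mul_right _ _ hz]
  unfold archUnitaryValue
  rw [Complex.ofReal_zero, zero_mul, Complex.cpow_zero, mul_one, ← key,
    show ((z / (‖z‖ : ℂ)) ^ 2)⁻¹ = (z / (‖z‖ : ℂ)) ^ (-2 : ℤ) by rw [zpow_neg, ← zpow_natCast]; norm_cast, ← zpow_mul]

/-- The other orientation: `(z ∕ conj z)^e = archUnitaryValue (2e) 0 z` (`z ≠ 0`). [cite: Rogawski1990, §12.3 p. 178] -/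
theorem archUnitaryValue_div_conj_self {z : ℂ} (hz : z ≠ 0) (e : ℤ) :
    (z / conj z) ^ e = archUnitaryValue (2 * e) 0 z := by
  have h := archUnitaryValue_conj_div_self hz (-e)
  rw [mul_neg, neg_mul, neg_neg, zpow_neg, ← inv_zpow, inv_div] at h
  exact h

/-- **TYPES ADD**: `archUnitaryValue (m + m′) (t + t′) z = archUnitaryValue m t z · archUnitaryValue m′ t′ z` (`z ≠ 0`). [cite: Patrikis2019, §2.1] -/
theorem archUnitaryValue_add {z : ℂ} (hz : z ≠ 0) (m m' : ℤ) (t t' : ℝ) :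
    archUnitaryValue (m + m') (t + t') z = archUnitaryValue m t z * archUnitaryValue m' t' z := by
  have hn : ((‖z‖ : ℝ) : ℂ) ≠ 0 := by exact_mod_cast (norm_pos_iff.2 hz).ne'
  have hu : z / (‖z‖ : ℂ) ≠ 0 := div_ne_zero hz hn
  unfold archUnitaryValue
  rw [zpow_add₀ hu, Complex.ofReal_add, add_mul, Complex.cpow_add _ _ hn]
  ring

/-- **THE LAST-ROW CHARACTER IN TYPES**: `archUnitaryValue m₁ t₁ (conj λ)⁻¹ · (conj λ ∕ λ)^{e₂} = archUnitaryValue (m₁ − 2e₂) (−t₁) λ` (`λ ≠ 0`) — `Θ_w(λ) = χ₁,w(λ̄⁻¹)·χ₂,w(λ̄∕λ)` for `χ₁,w` of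
type `(m₁, t₁)` and `χ₂,w = (·)^{e₂}` on `U(1)`: ONE integer `m_w = m₁ − 2e₂` and the real parameter `−t₁`. [cite: Patrikis2019, §2.1] [cite: Rogawski1990, §13.9 p. 229] -/
theorem theta_eq_archUnitaryValue {z : ℂ} (hz : z ≠ 0) (m₁ e₂ : ℤ) (t₁ : ℝ) :
    archUnitaryValue m₁ t₁ (conj z)⁻¹ * (conj z / z) ^ e₂ = archUnitaryValue (m₁ - 2 * e₂) (-t₁) z := by
  rw [archUnitaryValue_conj_inv hz, archUnitaryValue_conj_div_self hz, sub_eq_add_neg, ← neg_mul,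
    show (-t₁ : ℝ) = -t₁ + 0 by rw [add_zero], archUnitaryValue_add hz, add_zero]

/-- **THE VALUE AT `−w`**: `archUnitaryValue M t (−w) = (−1)^M · archUnitaryValue M t w`. [cite: Patrikis2019, §2.1] -/
theorem archUnitaryValue_neg (M : ℤ) (t : ℝ) (w : ℂ) : archUnitaryValue M t (-w) = (-1) ^ M * archUnitaryValue M t w := by
  unfold archUnitaryValue
  rw [norm_neg, neg_div, neg_eq_neg_one_mul (w / _), mul_zpow, mul_assoc]

/-- **THE VALUE AT `conj w`**: `archUnitaryValue M t (conj w) = conj (archUnitaryValue M (−t) w)` (the unit part conjugates; `conj(|w|^{−it}) = |w|^{it}` for the positive real base).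
[cite: Patrikis2019, §2.1] -/
theorem archUnitaryValue_conj (M : ℤ) (t : ℝ) (w : ℂ) : archUnitaryValue M t (conj w) = conj (archUnitaryValue M (-t) w) := by
  unfold archUnitaryValue
  rw [map_mul, Complex.norm_conj, map_zpow₀, map_div₀, Complex.conj_ofReal]
  congr 1
  have harg : ((‖w‖ : ℝ) : ℂ).arg ≠ Real.pi := by rw [Complex.arg_ofReal_of_nonneg (norm_nonneg w)]; exact Real.pi_pos.ne
  have h := Complex.conj_cpow ((‖w‖ : ℝ) : ℂ) ((t : ℂ) * Complex.I) harg
  rw [Complex.conj_ofReal, map_mul, Complex.conj_ofReal, Complex.conj_I] at h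
  rw [h]
  congr 2
  push_cast
  ring

/-- **ON THE BIG CELL** (`λ = ℓ_w = Z_w − 1 = −conj W`, `W = Z^{CS}_w = 1 − Z̄_w = A_w + iB_w s_w`): `archUnitaryValue M t (−conj W) = (−1)^M · conj (archUnitaryValue M (−t) W)`, i.e.
`(−1)^M (conj W∕|W|)^M |W|^{it}` — R90-CS-p03's (4b) integrand with the sign `ε = (−1)^M` and NO `X_w`-phase. [cite: MoeglinWaldspurger1995, IV.1.11] [cite: Rogawski1990, §13.9 p. 229] -/
theorem archUnitaryValue_neg_conj (M : ℤ) (t : ℝ) (W : ℂ) :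
    archUnitaryValue M t (-(conj W)) = (-1) ^ M * conj (archUnitaryValue M (-t) W) := by
  rw [archUnitaryValue_neg, archUnitaryValue_conj]

/-- `Z − 1 = −conj (1 − conj Z)` — the last-row functional `ℓ = x₂ − x₀` on the big cell (`(1, X, Z) ↦ Z − 1`, ★ `ell_row_two_bigCell`) is `−conj Z^{CS}` with `Z^{CS} := 1 − Z̄`. [folklore] -/
theorem sub_one_eq_neg_conj (Z : ℂ) : Z - 1 = -(conj (1 - conj Z)) := by
  rw [map_sub, map_one, Complex.conj_conj, neg_sub]

/-- **THE BIG-CELL WEIGHT IN TYPES**: `archUnitaryValue m₁ t₁ (conj (Z − 1))⁻¹ · (conj (Z − 1) ∕ (Z − 1))^{e₂} = (−1)^{m₁ − 2e₂} · conj (archUnitaryValue (m₁ − 2e₂) t₁ (1 − conj Z))` (`Z ≠ 1`): the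
archimedean last-row character on the cell is `ε·(conj Z^{CS}∕|Z^{CS}|)^{m_w}·|Z^{CS}|^{−it₁}`, `m_w = m₁ − 2e₂`, `ε = (−1)^{m_w}`. [cite: MoeglinWaldspurger1995, IV.1.11] [cite: Rogawski1990, §13.9 p. 229] -/
theorem theta_bigCell_eq {Z : ℂ} (hZ : Z ≠ 1) (m₁ e₂ : ℤ) (t₁ : ℝ) :
    archUnitaryValue m₁ t₁ (conj (Z - 1))⁻¹ * (conj (Z - 1) / (Z - 1)) ^ e₂ = (-1) ^ (m₁ - 2 * e₂) * conj (archUnitaryValue (m₁ - 2 * e₂) t₁ (1 - conj Z)) := by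
  rw [theta_eq_archUnitaryValue (sub_ne_zero.2 hZ), sub_one_eq_neg_conj, archUnitaryValue_neg_conj, neg_neg]

/-! ## §2 (ED. 2) THE ADELIC EVALUATION: ★ `lastRowChar χ₁ ξ.ψ` at an archimedean idele `(λ, 1)` is `∏_w archUnitaryValue (m₁ + 2eψ) (−t₁) (ι_w λ_w)` -/

section Adelic

open NumberField Literature.NumberTheory.Automorphic Literature.NumberTheory.Automorphic.UnitaryGroup
open Literature.NumberTheory.Automorphic.Arthur2013.Leaves.TECR Literature.NumberTheory.Rogawski1990
open Summit.HodgeConjecture.HodgeConjecture.R90.S8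

variable (L : Type) [Field L] [NumberField L] [IsCMField L]

/-- `(archUnitaryValue m t z)⁻¹ = archUnitaryValue m t z⁻¹` (`z ≠ 0`; a character of `ℂ^×`, ★ `archUnitaryValue_mul`). [cite: Patrikis2019, §2.1] -/
theorem archUnitaryValue_inv {z : ℂ} (hz : z ≠ 0) (m : ℤ) (t : ℝ) : (archUnitaryValue m t z)⁻¹ = archUnitaryValue m t z⁻¹ := by
  have h := archUnitaryValue_mul hz (inv_ne_zero hz) m t
  rw [mul_inv_cancel₀ hz, show archUnitaryValue m t 1 = 1 by simp [archUnitaryValue]] at h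
  exact inv_eq_of_mul_eq_one_right h.symm

/-- ★ `idelePhase X = ⟨(c•X)·X⁻¹⟩`, read in the torus `T(𝔸_{L⁺})`, IS the Hilbert-90 twist ★ `TorusDict.twistToTorus c X = c•X ∕ X`. [cite: Rogawski1990, §1.9] -/
theorem adelicOneEquivTorus_idelePhase (X : (AdeleRing (𝓞 L) L)ˣ) :
    adelicOneEquivTorus (↥(maximalRealSubfield L)) L (IsCMField.complexConj L) (idelePhase L X) =
      TorusDict.twistToTorus (IsCMField.complexConj L) (Algebra.IsQuadraticExtension.finrank_eq_two _ L) (IsCMField.complexConj_ne_one (K := L)) X := by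
  apply Subtype.ext
  rw [coe_adelicOneEquivTorus, coe_idelePhase, TorusDict.coe_twistToTorus_apply, Literature.NumberTheory.GaloisRepresentations.Herbrand.twist_apply,
    show Units.map (conjAdele (↥(maximalRealSubfield L)) L (IsCMField.complexConj L) : AdeleRing (𝓞 L) L →* AdeleRing (𝓞 L) L) X = IsCMField.complexConj L • X from Units.ext rfl, div_eq_mul_inv]

/-- **`χ₂⟨(c•X)X⁻¹⟩ = ψ̃(X)`**: the `χ₂ = ξ.ψ`-factor of ★ `lastRowChar` is the base change ★ `ξ.bcψ = ψ ∘ (z ↦ c•z∕z)` (★ `TorusDict.pullback`). [cite: Rogawski1990, §12.2 p. 174] -/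
theorem adelicOneChar_idelePhase (ξ : OneDimAutRepH L) (X : (AdeleRing (𝓞 L) L)ˣ) :
    adelicOneChar (↥(maximalRealSubfield L)) L (IsCMField.complexConj L) ξ.ψ (idelePhase L X) = ξ.bcψ X := by
  rw [adelicOneChar_apply, adelicOneEquivTorus_idelePhase, OneDimAutRepH.bcψ_apply]

/-- **THE LAST-ROW CHARACTER AT AN ARCHIMEDEAN IDELE, IN TYPES**: for `χ₁` of unitary archimedean type `(m₁, t₁)` (★ `HasUnitaryArchType`) and `χ₂ = ξ.ψ` (★ `OneDimAutRepH`, base change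
of type `(2eψ, 0)`), at the idele `(λ, 1)` of `λ ∈ (L ⊗ ℝ)^×`:
`Θ((λ,1)) = χ₁((c•λ, 1)⁻¹)·ψ̃((λ, 1)) = ∏_w archUnitaryValue (m₁,w + 2eψ,w) (−t₁,w) (ι_w λ_w)` — `c` acts on each archimedean coordinate by complex conjugation (★ `TorusDict.extensionEmbedding_smul`),
`archUnitaryValue m t (conj z)⁻¹ = archUnitaryValue m (−t) z` (§1), and types add.  On the big cell `λ_w = Z_w − 1` and §1 `theta_bigCell_eq` ∕ `archUnitaryValue_neg_conj` give
`ε·(conj Z^{CS}∕|Z^{CS}|)^{m_w}·|Z^{CS}|^{−it₁}` with **`m_w = m₁,w + 2eψ,w`** (for the block of record `χ₁ = ξ.bcη⁻¹·ξ.bcψ⁻¹·μω`: `m₁ = kμ − 2eη − 2eψ`, so `m_w = kμ,w − 2eη,w`, and `t₁ = 0`).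
[cite: Patrikis2019, §2.1] [cite: Rogawski1990, §12.2 p. 174; §13.9 p. 229] [cite: MoeglinWaldspurger1995, IV.1.11] -/
theorem lastRowChar_infiniteIdeles (ξ : OneDimAutRepH L) {χ₁ : HeckeCharacter L} {m₁ : InfinitePlace L → ℤ} {t₁ : InfinitePlace L → ℝ}
    (hχ₁ : χ₁.HasUnitaryArchType m₁ t₁) (y : (InfiniteAdeleRing L)ˣ) :
    lastRowChar L χ₁ ξ.ψ ((infiniteIdeles L y : ideleGroup L) : AdeleRing (𝓞 L) L) =
      ∏ w : InfinitePlace L, archUnitaryValue (m₁ w + 2 * ξ.eψ w) (-t₁ w) (InfinitePlace.Completion.extensionEmbedding w ((y : InfiniteAdeleRing L) w)) := by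
  rw [lastRowChar_coe_units, adelicOneChar_idelePhase,
    show Units.map (conjAdele (↥(maximalRealSubfield L)) L (IsCMField.complexConj L) : AdeleRing (𝓞 L) L →* AdeleRing (𝓞 L) L) (infiniteIdeles L y) =
      IsCMField.complexConj L • infiniteIdeles L y from Units.ext rfl, TorusDict.smul_infiniteIdeles]
  have h1 : ((χ₁ (infiniteIdeles L (IsCMField.complexConj L • y)) : ℂˣ) : ℂ) =
      ∏ w : InfinitePlace L, archUnitaryValue (m₁ w) (t₁ w) (conj (InfinitePlace.Completion.extensionEmbedding w ((y : InfiniteAdeleRing L) w))) := by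
    rw [hχ₁ (IsCMField.complexConj L • y)]
    refine Finset.prod_congr rfl fun w _ => ?_
    rw [TorusDict.extensionEmbedding_smul (IsCMField.complexConj L) (Algebra.IsQuadraticExtension.finrank_eq_two _ L) (IsCMField.complexConj_ne_one (K := L))
      inferInstance inferInstance y w]
  have h2 : ((ξ.bcψ (infiniteIdeles L y) : ℂˣ) : ℂ) =
      ∏ w : InfinitePlace L, archUnitaryValue (2 * ξ.eψ w) 0 (InfinitePlace.Completion.extensionEmbedding w ((y : InfiniteAdeleRing L) w)) :=
    ξ.hasUnitaryArchType_bcψ y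
  rw [map_inv, Units.val_inv_eq_inv_val, h1, h2, ← Finset.prod_inv_distrib, ← Finset.prod_mul_distrib]
  refine Finset.prod_congr rfl fun w _ => ?_
  have hz := Literature.NumberTheory.GaloisRepresentations.InfiniteIdele.extensionEmbedding_apply_ne_zero y w
  rw [archUnitaryValue_inv ((map_ne_zero _).2 hz), archUnitaryValue_conj_inv hz, ← archUnitaryValue_add hz, add_zero]

/-- **… ON THE BIG CELL**: if the archimedean idele `λ` has coordinates `ι_w λ_w = Z_w − 1` (the last-row functional `ℓ = x₂ − x₀` of `ι(w₀)u(X, θs)`, ★ `ell_row_two_bigCell`), then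
`Θ((λ, 1)) = ∏_w (−1)^{m_w}·conj (archUnitaryValue m_w (t₁,w) (1 − conj Z_w))`, `m_w = m₁,w + 2eψ,w` — the (4b) Beta integrand `ε·(conj Z^{CS}∕|Z^{CS}|)^{m_w}|Z^{CS}|^{−it₁}` per place,
`Z^{CS}_w = 1 − conj Z_w = A_w + iB_w s_w`, NO `X_w`-phase. [cite: MoeglinWaldspurger1995, IV.1.11] [cite: Rogawski1990, §13.9 p. 229] -/
theorem lastRowChar_infiniteIdeles_bigCell (ξ : OneDimAutRepH L) {χ₁ : HeckeCharacter L} {m₁ : InfinitePlace L → ℤ} {t₁ : InfinitePlace L → ℝ}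
    (hχ₁ : χ₁.HasUnitaryArchType m₁ t₁) (y : (InfiniteAdeleRing L)ˣ) (Z : InfinitePlace L → ℂ)
    (hy : ∀ w : InfinitePlace L, InfinitePlace.Completion.extensionEmbedding w ((y : InfiniteAdeleRing L) w) = Z w - 1) :
    lastRowChar L χ₁ ξ.ψ ((infiniteIdeles L y : ideleGroup L) : AdeleRing (𝓞 L) L) =
      ∏ w : InfinitePlace L, (-1) ^ (m₁ w + 2 * ξ.eψ w) * conj (archUnitaryValue (m₁ w + 2 * ξ.eψ w) (t₁ w) (1 - conj (Z w))) := by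
  rw [lastRowChar_infiniteIdeles L ξ hχ₁ y]
  refine Finset.prod_congr rfl fun w _ => ?_
  rw [hy w, sub_one_eq_neg_conj, archUnitaryValue_neg_conj, neg_neg]

/-! ### §3 ★ `archSectionL` BY NAME on an element of `G_∞` whose last-row functional `ℓ = x₂ − x₀` is the archimedean idele `(λ, 1)` -/

open Literature.NumberTheory.Automorphic.UnitaryGroup.AdelicCharactersDetQuasiSplit (antidiagonal_over_det_ne_zero) in
/-- **★ `archSectionL χ₁ ξ.ψ` IN TYPES**: for `a ∈ G_∞ = U(J₃)(L ⊗ ℝ)` whose last-row functional `ℓ(a) = (ι_∞ a)₂₂ − (ι_∞ a)₂₀` (★ `archLastRowL`) is the archimedean idele `(λ, 1)` (hypothesis `hℓ`;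
on the big cell `λ_w = Z_w − 1`, finite part `1 − 0 = 1`), and `χ₁` of unitary archimedean type `(m₁, t₁)`:
`archSectionL χ₁ ξ.ψ a = (∏_w archUnitaryValue (m₁,w + 2eψ,w) (−t₁,w) (ι_w λ_w)) · ρ_ℓ(a) · ξ.ψ⟨det ι_∞ a⟩` (★ `archSectionL_def` + §2). [cite: BorelJacquet1979, §4.1] [cite: Rogawski1990, §13.9 p. 229] -/
theorem archSectionL_eq_of_archLastRowL_eq (ξ : OneDimAutRepH L) {χ₁ : HeckeCharacter L} {m₁ : InfinitePlace L → ℤ} {t₁ : InfinitePlace L → ℝ}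
    (hχ₁ : χ₁.HasUnitaryArchType m₁ t₁) (a : arch (↥(maximalRealSubfield L)) L (IsCMField.complexConj L) 3 ((StdForm.antidiagonal 3).over L)) (y : (InfiniteAdeleRing L)ˣ)
    (hℓ : archLastRowL L a = ((infiniteIdeles L y : ideleGroup L) : AdeleRing (𝓞 L) L)) :
    archSectionL L χ₁ ξ.ψ a =
      (∏ w : InfinitePlace L, archUnitaryValue (m₁ w + 2 * ξ.eψ w) (-t₁ w) (InfinitePlace.Completion.extensionEmbedding w ((y : InfiniteAdeleRing L) w))) *
        (archRowFactorL L a : ℂ) *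
      ((adelicOneChar (↥(maximalRealSubfield L)) L (IsCMField.complexConj L) ξ.ψ
        (adelicDet (↥(maximalRealSubfield L)) L (IsCMField.complexConj L) 3 ((StdForm.antidiagonal 3).over L) (antidiagonal_over_det_ne_zero L 3)
          (archToAdelic (↥(maximalRealSubfield L)) L (IsCMField.complexConj L) 3 ((StdForm.antidiagonal 3).over L) a)) : ℂˣ) : ℂ) := by
  rw [archSectionL_def, hℓ, lastRowChar_infiniteIdeles L ξ hχ₁ y]

open Literature.NumberTheory.Automorphic.UnitaryGroup.AdelicCharactersDetQuasiSplit (antidiagonal_over_det_ne_zero) in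
/-- **… AND ON THE BIG CELL** (`ι_w λ_w = Z_w − 1`): `archSectionL χ₁ ξ.ψ a = (∏_w (−1)^{m_w} conj (archUnitaryValue m_w t₁,w (1 − conj Z_w))) · ρ_ℓ(a) · ξ.ψ⟨det ι_∞ a⟩`, `m_w = m₁,w + 2eψ,w` — the archimedean
weight of K2E1-p11's witness section on the cell: `ε·(conj Z^{CS}∕|Z^{CS}|)^{m_w}·|Z^{CS}|^{−it₁}` per place times the positive factor `ρ_ℓ` and the constant `ξ.ψ⟨det⟩`.
[cite: MoeglinWaldspurger1995, IV.1.11] [cite: Rogawski1990, §13.9 p. 229] -/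
theorem archSectionL_bigCell (ξ : OneDimAutRepH L) {χ₁ : HeckeCharacter L} {m₁ : InfinitePlace L → ℤ} {t₁ : InfinitePlace L → ℝ}
    (hχ₁ : χ₁.HasUnitaryArchType m₁ t₁) (a : arch (↥(maximalRealSubfield L)) L (IsCMField.complexConj L) 3 ((StdForm.antidiagonal 3).over L)) (y : (InfiniteAdeleRing L)ˣ) (Z : InfinitePlace L → ℂ)
    (hℓ : archLastRowL L a = ((infiniteIdeles L y : ideleGroup L) : AdeleRing (𝓞 L) L))
    (hy : ∀ w : InfinitePlace L, InfinitePlace.Completion.extensionEmbedding w ((y : InfiniteAdeleRing L) w) = Z w - 1) :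
    archSectionL L χ₁ ξ.ψ a =
      (∏ w : InfinitePlace L, (-1) ^ (m₁ w + 2 * ξ.eψ w) * conj (archUnitaryValue (m₁ w + 2 * ξ.eψ w) (t₁ w) (1 - conj (Z w)))) *
        (archRowFactorL L a : ℂ) *
      ((adelicOneChar (↥(maximalRealSubfield L)) L (IsCMField.complexConj L) ξ.ψ
        (adelicDet (↥(maximalRealSubfield L)) L (IsCMField.complexConj L) 3 ((StdForm.antidiagonal 3).over L) (antidiagonal_over_det_ne_zero L 3)
          (archToAdelic (↥(maximalRealSubfield L)) L (IsCMField.complexConj L) 3 ((StdForm.antidiagonal 3).over L) a)) : ℂˣ) : ℂ) := by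
  rw [archSectionL_def, hℓ, lastRowChar_infiniteIdeles_bigCell L ξ hχ₁ y Z hy]

end Adelic

/-! ## §4 (ED. 3) THE `m_w` TABLE OF THE BLOCK OF RECORD: `χ₁ = ξ.bcη⁻¹·ξ.bcψ⁻¹·μω` has type `(kμ − 2eη − 2eψ, 0)`, so `m_w = m₁,w + 2eψ,w = kμ,w − 2eη,w` -/

section Table

open NumberField Literature.NumberTheory.Automorphic Literature.NumberTheory.Automorphic.UnitaryGroup
open Literature.NumberTheory.Automorphic.Arthur2013.Leaves.TECR Literature.NumberTheory.Rogawski1990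
open Summit.HodgeConjecture.HodgeConjecture.R90.S8

variable (L : Type) [Field L] [NumberField L] [IsCMField L]

/-- `archUnitaryValue 0 0 z = 1`. [folklore] -/
theorem archUnitaryValue_zero_zero (z : ℂ) : archUnitaryValue 0 0 z = 1 := by
  simp [archUnitaryValue]

/-- `(archUnitaryValue e 0 z)⁻¹ = archUnitaryValue (−e) 0 z` (`z ≠ 0`). [cite: Patrikis2019, §2.1] -/
theorem inv_archUnitaryValue_zero_right {z : ℂ} (hz : z ≠ 0) (e : ℤ) : (archUnitaryValue e 0 z)⁻¹ = archUnitaryValue (-e) 0 z := by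
  have h := archUnitaryValue_add hz e (-e) 0 0
  rw [add_neg_cancel, add_zero, archUnitaryValue_zero_zero] at h
  exact inv_eq_of_mul_eq_one_right h.symm

/-- **`μω` IS A SPLITTING CHARACTER OF PARITY `1`** (★ `HarrisKudlaSweet1996.IsSplittingChar L 1`): the frame's `hquad : μω ∘ 𝕀-base-change = ε_{L∕L⁺}` IS that, so ★
`IsSplittingChar.exists_hasUnitaryArchType` gives `μω` a unitary archimedean type `(kμ, 0)` with every `kμ,w` ODD. [cite: Liu2021, Remark 4.2] -/
theorem exists_hasUnitaryArchType_of_hquad {μω : HeckeCharacter L} (hμu : μω.IsUnitary)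
    (hquad : ∀ x : Literature.NumberTheory.GaloisRepresentations.ideleGroup ↥(maximalRealSubfield L), μω (AdeleRing.ideleBaseChange (↥(maximalRealSubfield L)) L x) = quadraticHeckeCharCM L x) :
    ∃ kμ : InfinitePlace L → ℤ, μω.HasUnitaryArchType kμ 0 ∧ ∀ w, kμ w ≡ 1 [ZMOD 2] := by
  have hs : Literature.RepresentationTheory.HarrisKudlaSweet1996.IsSplittingChar L 1 μω := fun x => by rw [pow_one]; exact hquad x
  exact_mod_cast hs.exists_hasUnitaryArchType hμu

/-- **THE MID-BLOCK CHARACTER's ARCHIMEDEAN TYPE**: if `μω` has unitary type `(kμ, 0)` then `χ₁ = ξ.bcη⁻¹·ξ.bcψ⁻¹·μω` has unitary type `(kμ − 2eη − 2eψ, 0)` (★ `hasUnitaryArchType_bcη∕bcψ`: types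
`(2eη, 0)`, `(2eψ, 0)`; inverses negate, products add). [cite: Patrikis2019, §2.1] [cite: Rogawski1990, §12.2 p. 174] -/
theorem hasUnitaryArchType_midBlockChar (ξ : OneDimAutRepH L) {μω : HeckeCharacter L} {kμ : InfinitePlace L → ℤ} (hμ : μω.HasUnitaryArchType kμ 0) :
    (ξ.bcη⁻¹ * ξ.bcψ⁻¹ * μω).HasUnitaryArchType (fun w => kμ w - 2 * ξ.eη w - 2 * ξ.eψ w) (fun _ => 0) := by
  intro x
  have hη : ((ξ.bcη (infiniteIdeles L x) : ℂˣ) : ℂ) = ∏ w : InfinitePlace L, archUnitaryValue (2 * ξ.eη w) 0 (InfinitePlace.Completion.extensionEmbedding w ((x : InfiniteAdeleRing L) w)) :=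
    ξ.hasUnitaryArchType_bcη x
  have hψ : ((ξ.bcψ (infiniteIdeles L x) : ℂˣ) : ℂ) = ∏ w : InfinitePlace L, archUnitaryValue (2 * ξ.eψ w) 0 (InfinitePlace.Completion.extensionEmbedding w ((x : InfiniteAdeleRing L) w)) :=
    ξ.hasUnitaryArchType_bcψ x
  have hμ' : ((μω (infiniteIdeles L x) : ℂˣ) : ℂ) = ∏ w : InfinitePlace L, archUnitaryValue (kμ w) 0 (InfinitePlace.Completion.extensionEmbedding w ((x : InfiniteAdeleRing L) w)) := hμ x
  show _ = ∏ w : InfinitePlace L, archUnitaryValue (kμ w - 2 * ξ.eη w - 2 * ξ.eψ w) 0 (InfinitePlace.Completion.extensionEmbedding w ((x : InfiniteAdeleRing L) w))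
  rw [HeckeCharacter.mul_apply, HeckeCharacter.mul_apply, HeckeCharacter.inv_apply, HeckeCharacter.inv_apply, Units.val_mul, Units.val_mul,
    Units.val_inv_eq_inv_val, Units.val_inv_eq_inv_val, hη, hψ, hμ', ← Finset.prod_inv_distrib, ← Finset.prod_inv_distrib, ← Finset.prod_mul_distrib,
    ← Finset.prod_mul_distrib]
  refine Finset.prod_congr rfl fun w _ => ?_
  have hz := Literature.NumberTheory.GaloisRepresentations.InfiniteIdele.extensionEmbedding_apply_ne_zero x w
  rw [inv_archUnitaryValue_zero_right hz, inv_archUnitaryValue_zero_right hz, ← archUnitaryValue_add hz, ← archUnitaryValue_add hz, add_zero, add_zero]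
  congr 1
  ring

/-- **THE `m_w` TABLE OF THE BLOCK OF RECORD** (per complex place, in types): for `μω` of unitary type `(kμ, 0)`, at the archimedean idele `(λ, 1)`,
`Θ((λ,1)) = lastRowChar (ξ.bcη⁻¹·ξ.bcψ⁻¹·μω) ξ.ψ (λ,1) = ∏_w archUnitaryValue (kμ,w − 2eη,w) 0 (ι_w λ_w)` — i.e. **`m_w = kμ,w − 2·ξ.eη w`, `t_w = 0`** (the coupling exponent `m₁ + 2eψ` of §2 with
`m₁ = kμ − 2eη − 2eψ`; `kμ,w` odd by `exists_hasUnitaryArchType_of_hquad`). [cite: Rogawski1990, §13.9 p. 229] [cite: MoeglinWaldspurger1995, IV.1.11] -/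
theorem lastRowChar_infiniteIdeles_midBlock (ξ : OneDimAutRepH L) {μω : HeckeCharacter L} {kμ : InfinitePlace L → ℤ} (hμ : μω.HasUnitaryArchType kμ 0)
    (y : (InfiniteAdeleRing L)ˣ) :
    lastRowChar L (ξ.bcη⁻¹ * ξ.bcψ⁻¹ * μω) ξ.ψ ((infiniteIdeles L y : ideleGroup L) : AdeleRing (𝓞 L) L) =
      ∏ w : InfinitePlace L, archUnitaryValue (kμ w - 2 * ξ.eη w) 0 (InfinitePlace.Completion.extensionEmbedding w ((y : InfiniteAdeleRing L) w)) := by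
  rw [lastRowChar_infiniteIdeles L ξ (hasUnitaryArchType_midBlockChar L ξ hμ) y]
  refine Finset.prod_congr rfl fun w _ => ?_
  rw [neg_zero]
  congr 1
  ring

/-- **… ON THE BIG CELL**: `ι_w λ_w = Z_w − 1` ⇒ `Θ((λ,1)) = ∏_w (−1)^{m_w}·conj (archUnitaryValue m_w 0 (1 − conj Z_w))`, `m_w = kμ,w − 2eη,w` — the archimedean weight of the block of record per place is
`ε·(conj Z^{CS}_w∕|Z^{CS}_w|)^{m_w}` (`t = 0`: no modulus phase), the input of ★ (a-10)∕(a-10b)'s Beta cores at `(−m_w, 3∕2)`. [cite: MoeglinWaldspurger1995, IV.1.11] [cite: Rogawski1990, §13.9 p. 229] -/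
theorem lastRowChar_infiniteIdeles_midBlock_bigCell (ξ : OneDimAutRepH L) {μω : HeckeCharacter L} {kμ : InfinitePlace L → ℤ} (hμ : μω.HasUnitaryArchType kμ 0)
    (y : (InfiniteAdeleRing L)ˣ) (Z : InfinitePlace L → ℂ) (hy : ∀ w : InfinitePlace L, InfinitePlace.Completion.extensionEmbedding w ((y : InfiniteAdeleRing L) w) = Z w - 1) :
    lastRowChar L (ξ.bcη⁻¹ * ξ.bcψ⁻¹ * μω) ξ.ψ ((infiniteIdeles L y : ideleGroup L) : AdeleRing (𝓞 L) L) =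
      ∏ w : InfinitePlace L, (-1) ^ (kμ w - 2 * ξ.eη w) * conj (archUnitaryValue (kμ w - 2 * ξ.eη w) 0 (1 - conj (Z w))) := by
  rw [lastRowChar_infiniteIdeles_midBlock L ξ hμ y]
  refine Finset.prod_congr rfl fun w _ => ?_
  rw [hy w, sub_one_eq_neg_conj, archUnitaryValue_neg_conj, neg_zero]

end Table

/-! ## §5 (ED. 4) THE SECTION OF RECORD ★ `archSectionE` (Euclidean `ρ_E ≡ 1`, ★ p11 3c-E `archRowFactorE_eq_one`) IN TYPES, and for the block of record -/

section SectionE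

open NumberField Literature.NumberTheory.Automorphic Literature.NumberTheory.Automorphic.UnitaryGroup
open Literature.NumberTheory.Automorphic.Arthur2013.Leaves.TECR Literature.NumberTheory.Rogawski1990
open Summit.HodgeConjecture.HodgeConjecture.R90.S8
open Literature.NumberTheory.Automorphic.UnitaryGroup.AdelicCharactersDetQuasiSplit (antidiagonal_over_det_ne_zero)

variable (L : Type) [Field L] [NumberField L] [IsCMField L]

/-- **★ `archSectionE χ₁ ξ.ψ` IN TYPES** (the archimedean section OF RECORD, Euclidean row norm, `ρ_E ≡ 1` by ★ `archRowFactorE_eq_one` ∕ ★ `archSectionE_eq`): for `a ∈ G_∞` whose last-row functional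
`ℓ(a)` is the archimedean idele `(λ, 1)` and `χ₁` of unitary type `(m₁, t₁)`: `archSectionE χ₁ ξ.ψ a = (∏_w archUnitaryValue (m₁,w + 2eψ,w) (−t₁,w) (ι_w λ_w)) · ξ.ψ⟨det ι_∞ a⟩` — a PURE PHASE times the
constant `ξ.ψ⟨det⟩`. [cite: BorelJacquet1979, §4.1] [cite: Rogawski1990, §13.9 p. 229] -/
theorem archSectionE_eq_of_archLastRowL_eq (ξ : OneDimAutRepH L) {χ₁ : HeckeCharacter L} {m₁ : InfinitePlace L → ℤ} {t₁ : InfinitePlace L → ℝ}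
    (hχ₁ : χ₁.HasUnitaryArchType m₁ t₁) (a : arch (↥(maximalRealSubfield L)) L (IsCMField.complexConj L) 3 ((StdForm.antidiagonal 3).over L)) (y : (InfiniteAdeleRing L)ˣ)
    (hℓ : archLastRowL L a = ((infiniteIdeles L y : ideleGroup L) : AdeleRing (𝓞 L) L)) :
    archSectionE L χ₁ ξ.ψ a =
      (∏ w : InfinitePlace L, archUnitaryValue (m₁ w + 2 * ξ.eψ w) (-t₁ w) (InfinitePlace.Completion.extensionEmbedding w ((y : InfiniteAdeleRing L) w))) *
      ((adelicOneChar (↥(maximalRealSubfield L)) L (IsCMField.complexConj L) ξ.ψ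
        (adelicDet (↥(maximalRealSubfield L)) L (IsCMField.complexConj L) 3 ((StdForm.antidiagonal 3).over L) (antidiagonal_over_det_ne_zero L 3)
          (archToAdelic (↥(maximalRealSubfield L)) L (IsCMField.complexConj L) 3 ((StdForm.antidiagonal 3).over L) a)) : ℂˣ) : ℂ) := by
  rw [archSectionE_eq, hℓ, lastRowChar_infiniteIdeles L ξ hχ₁ y]

/-- **★ `archSectionE` FOR THE BLOCK OF RECORD ON THE BIG CELL** (`χ₁ = ξ.bcη⁻¹·ξ.bcψ⁻¹·μω`, `μω` of type `(kμ, 0)`, `ι_w λ_w = Z_w − 1`):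
`archSectionE χ₁ ξ.ψ a = (∏_w (−1)^{m_w}·conj (archUnitaryValue m_w 0 (1 − conj Z_w))) · ξ.ψ⟨det ι_∞ a⟩`, `m_w = kμ,w − 2eη,w` — the weights of ★ p863862 with `ρ_E = 1`: the line
R90-CS-p03's `K2E1ChiArchA32OfRecordU3` consumes (its `hρE` letter DISCHARGED). [cite: MoeglinWaldspurger1995, IV.1.11] [cite: Rogawski1990, §13.9 p. 229] -/
theorem archSectionE_midBlock_bigCell (ξ : OneDimAutRepH L) {μω : HeckeCharacter L} {kμ : InfinitePlace L → ℤ} (hμ : μω.HasUnitaryArchType kμ 0)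
    (a : arch (↥(maximalRealSubfield L)) L (IsCMField.complexConj L) 3 ((StdForm.antidiagonal 3).over L)) (y : (InfiniteAdeleRing L)ˣ) (Z : InfinitePlace L → ℂ)
    (hℓ : archLastRowL L a = ((infiniteIdeles L y : ideleGroup L) : AdeleRing (𝓞 L) L))
    (hy : ∀ w : InfinitePlace L, InfinitePlace.Completion.extensionEmbedding w ((y : InfiniteAdeleRing L) w) = Z w - 1) :
    archSectionE L (ξ.bcη⁻¹ * ξ.bcψ⁻¹ * μω) ξ.ψ a =
      (∏ w : InfinitePlace L, (-1) ^ (kμ w - 2 * ξ.eη w) * conj (archUnitaryValue (kμ w - 2 * ξ.eη w) 0 (1 - conj (Z w)))) *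
      ((adelicOneChar (↥(maximalRealSubfield L)) L (IsCMField.complexConj L) ξ.ψ
        (adelicDet (↥(maximalRealSubfield L)) L (IsCMField.complexConj L) 3 ((StdForm.antidiagonal 3).over L) (antidiagonal_over_det_ne_zero L 3)
          (archToAdelic (↥(maximalRealSubfield L)) L (IsCMField.complexConj L) 3 ((StdForm.antidiagonal 3).over L) a)) : ℂˣ) : ℂ) := by
  rw [archSectionE_eq, hℓ, lastRowChar_infiniteIdeles_midBlock_bigCell L ξ hμ y Z hy]

/-- **UNIFORM MODULUS**: under the same hypotheses each archimedean weight factor has modulus one — `‖(−1)^{m}·conj (archUnitaryValue m 0 W)‖ = 1` for `W ≠ 0` (★ `norm_archUnitaryValue`).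
[cite: Patrikis2019, §2.1] -/
theorem norm_neg_one_zpow_mul_conj_archUnitaryValue {W : ℂ} (hW : W ≠ 0) (m : ℤ) : ‖((-1 : ℂ) ^ m) * conj (archUnitaryValue m 0 W)‖ = 1 := by
  rw [norm_mul, norm_zpow, norm_neg, norm_one, one_zpow, one_mul, Complex.norm_conj, norm_archUnitaryValue hW]

end SectionE

end Summit.HodgeConjecture.HodgeConjecture.Cruxes.H413.K2E1ArchSectionLOnBigCellU3

end
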